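import Summits.Parity.BatemanHorn.Theses.HurwitzTauber
import Summits.Parity.BatemanHorn.Theses.LambertRoots

/-!
# Birth skeleton — crux `RootHurwitzLaw` (route `HurwitzTauber`, item `stmt-Parity-19024`) — line `birth` (BC3)

planner-skel-stmt-Parity-19024-0 (skeleton registrar, one-shot; route re-audit bin HONEST), 2026-08-17.
Target: the route decl `Summit.Parity.BatemanHorn.Theses.HurwitzTauber.RootHurwitzLaw` BY NAME (rev 2 of the
route file), concluded by `RootHurwitzLaw_of` from three named stubs (the only `sorry`s of this file); the
hypothesis form `stub₁-sig → stub₂-sig → stub₃-sig → RootHurwitzLaw` is the kernel-checked `example` next to it.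

## The crux (fixed; not restated)

For every Bateman–Horn system `f = (f₁,…,f_k)` put, for `σ > 1`, `n ≥ 1` and a divisor tuple `d = (dᵢ)`,
`dᵢ ∣ fᵢ(n)` (all `fᵢ(n) > 0`), `L = lcm d < n`, `m = ⌊(n-1)/L⌋ ≥ 1`, `a = L·m` (so `a < n ≤ a + L`):

  `δ_σ(n,d) = n^{-σ} - ((a+L)^{1-σ} - a^{1-σ}) / ((1-σ)L)`      (= `n^{-σ}` minus the mean of `u^{-σ}` on `[a, a+L]`),
  `R(σ,n)   = Σ_d ∏ᵢ μ(dᵢ) log dᵢ · δ_σ(n,d)`,   `Rm(σ) = Σ_n R(σ,n)`.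

Crux: `Rm(σ)` is summable for `σ > 1` and `(σ-1)·Rm(σ) → 0` (`σ → 1⁺`).  Writing `n = L(m+α)`, `α ∈ (0,1]`,
one has EXACTLY `δ_σ(n,d) = L^{-σ}·t_m(α)`, `t_m(α) = (m+α)^{-σ} - ∫_m^{m+1} v^{-σ} dv`, and per root class
`Σ_{m ≥ 1} t_m(α) = Φ_σ(α) := ζ(σ,1+α) - 1/(σ-1)`, the route's mean-zero Hurwitz kernel (`∫₀¹ Φ_σ = 0`).

## The line: cut the KERNEL, not the range — jump (sawtooth) part ⊕ continuous part

`Φ_σ` is smooth on `(0,1)` but its periodisation has a UNIT JUMP at the integers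
(`Φ_σ(0⁺) - Φ_σ(1) = ζ(σ,1) - ζ(σ,2) = 1`: the sharp block cut `lcm d < n` of the route), and blockwise the jump
of `t_m` is `J_m = t_m(0⁺) - t_m(1) = m^{-σ} - (m+1)^{-σ}` (`Σ_{m≥1} J_m = 1`).  Split every term:

  `δ_σ(n,d) = L^{-σ}·J_m·(1/2 - α)  +  L^{-σ}·g_m(α)`,   `α = (n - a)/L`,   `g_m := t_m - J_m·(1/2 - ·)`,

where each `g_m` is CONTINUOUS-PERIODIC (`g_m(0⁺) = g_m(1)`), so `G_σ := Σ_m g_m = Φ_σ - (1/2 - ·)` is a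
continuous, mean-zero, piecewise-`C^∞` periodic function with a kink: `Ĝ_σ(h) = O(h^{-2})` uniformly in
`σ ∈ (1,2]`, `Ĝ_σ(0) = 0`.  Accordingly `R = W + G` termwise (`remainder_eq_saw_add_smooth`, proved by `ring`) with

* `W(σ,n) = Σ_d ∏μ log · L^{-σ} J_m (1/2 - α)` — the SAWTOOTH piece.  Per class it telescopes (`Σ_m J_m = 1`) to
  `Σ_d ∏ᵢ μ(dᵢ) log dᵢ · L^{-σ} · M₁(d)`, `M₁(d) = Σ_{ν ∈ R(d)} (1/2 - α(ν))` the CENTRED FIRST MOMENT of the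
  joint root classes `ν/L` (`α(0) = 1`): stub `stub_sawtoothMoment` = "the `μ⊗log`-twisted, Abel-weighted first
  root moment is `o(1/(σ-1))`" (Cesàro form for `k = 1`: `Σ_{d ≤ x} μ(d) log d · M₁(d) = o(x)`).  Its Fourier
  series has `1/h` coefficients, so it is NOT a bounded-frequency Weyl-sum statement: it needs either
  `μ`-cancellation at frequencies up to `(log x)^{1+ε}` with `1/h` weights, or an untwisted root-discrepancy law
  with one full logarithm of saving (degree ≤ 2: Hooley 1963 / DFI 1995 / Tóth 2000 grade; degree ≥ 3: beyond
  Hooley 1964's `(log)^{-δ}`) — the NEW content of the crux (pricing note of idea-node g30 attached to the item,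
  `note-19024-sawtooth-first-moment.md`).
* `G(σ,n) = R(σ,n) - W(σ,n)` — the CONTINUOUS-KERNEL piece `Σ_d ∏μ log · L^{-σ} Σ_ν G_σ(ν/L)`.  Expanding
  `G_σ(ν/L) = Σ_{h ≠ 0} Ĝ_σ(h) e(hν/L)` (absolutely convergent) turns it into `Σ_{h≠0} Ĝ_σ(h) · Σ_d ∏μ log ·
  L^{-σ} S_f(h; d)` with the JOINT-ROOT WEYL SUMS `S_f(h;d) = Σ_{ν ∈ R(d)} e(hν/L)` — exactly the sums of the
  sibling crux `LambertRoots.MuRootWeyl` (stmt-Parity-16279: `|Σ_{lcm d ≤ D} ∏μ log · S_f(j;d)| ≤ C·D/(log D)^A`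
  for `0 < |j| ≤ (log D)^B`, all `A, B > 0`).  Abel summation `L^{-σ} = ∫ σ D^{-σ-1} 1_{L ≤ D} dD`, MuRootWeyl
  with `A > 1`, `B > 2k` where `|h| ≤ (log D)^B`, and the trivial bound `Σ_{lcm ≤ D} |∏μ log|·|R(d)| ≪ D(log D)^{2k-1}`
  on `D < exp(|h|^{1/B})` (cost `|h|^{2k/B}`, summable against `h^{-2}`) give `Σ_n G(σ,n) = O(1)`, a fortiori
  `(σ-1)·Σ_n G → 0`.  So the piece is registered as TWO stubs: `stub_muRootWeyl` (= stmt-Parity-16279 BY NAME,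
  the sign input; staffed once, on route LambertRoots) and the theorem-grade TRANSFER `stub_smoothKernel :
  MuRootWeyl → (G summable ∧ (σ-1)Σ G → 0)` (Fourier series of `G_σ` on `AddCircle`, partial summation,
  exchange of the absolutely convergent `(n,d)`-sum into classes; the finitely many `n` with some `fᵢ(n) ≤ 0`
  touch only tuples with `L < n₀(f)`, an `O(1)`).

`RootHurwitzLaw_of` assembles: `R = W + G` termwise ⇒ `Summable (R σ)` from the two summabilities and
`(σ-1)Σ'R = (σ-1)Σ'W + (σ-1)Σ'G → 0 + 0` (`law_of_parts`, proved).  The split is EXACT modulo the sibling crux: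
given the crux and `stub_smoothKernel stub_muRootWeyl`, the sawtooth stub follows (`W = R - G`), so nothing is
lost; neither open stub is the crux reworded (W is a first-moment law with no Hurwitz kernel; MuRootWeyl is a
bounded-frequency exponential-sum bound of another route) and none mentions `BatemanHorn`.
Sanity (by hand): `k = 0` (empty system, `L = 1`, `α = 1`): `Σ_n W = -1/2`, `Σ_n G = ζ(σ) - 1/2 - 1/(σ-1) → γ - 1/2`;
`f = X` (`ν = 0`, `α = 1`): `Σ_n W = -(1/2)·Σ_d μ(d) log d · d^{-σ} = -(ζ'/ζ²)(σ)/2 → 1/2` — both stubs' conclusions are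
TRUE there, as is the crux (refuter rattack-19024: `k = 0`, `f = X`, `f = aX+b` true; `pairwise_not_associated`
load-bearing).

Disproof used: none exists — `ledger crux ls stmt-Parity-19024` shows no workfiles (no `Disproof.lean`, no
`_false_without_` theorem, no landed `Theorems/RootHurwitzLaw/Negative/*`); `ledger negatives --problem Parity`
lists three GHL-side statements (stmt-Parity-9541, 14832, 4218), none about Hurwitz remainders, root moments or
root Weyl sums.  Dead lines: none recorded for this crux.
-/

namespace Summit.Parity.BatemanHorn.Cruxes.RootHurwitzLaw.Birth

open scoped BigOperators
open Filter

/-! ### Registered stubs (the only `sorry`s of the line) -/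

/-- stub (SAWTOOTH PIECE = twisted first root moment; the new content of the crux — size XL for a member of
degree ≥ 3, L for systems of linear/quadratic members): for every Bateman–Horn system `f`, with
`W(σ,n) = Σ_{d : dᵢ ∣ fᵢ(n), L = lcm d < n} ∏ᵢ μ(dᵢ) log dᵢ · L^{-σ} (m^{-σ} - (m+1)^{-σ}) (1/2 - (n - L·m)/L)`,
`m = ⌊(n-1)/L⌋`, the series `Σ_n W(σ,n)` is summable for `σ > 1` and `(σ-1)·Σ_n W(σ,n) → 0` as `σ → 1⁺`.
Per joint root class the block factor telescopes (`Σ_{m≥1}(m^{-σ} - (m+1)^{-σ}) = 1`), so this is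
`Σ_d ∏μ(dᵢ)log dᵢ · lcm(d)^{-σ} · M₁(d) = o(1/(σ-1))` with `M₁(d) = Σ_{ν ∈ R(d)} (1/2 - α(ν))` the centred first
moment of the root classes (`α(ν) = ν/L`, `α(0) = 1`).  Why plausibly true: Möbius randomness in `d` and/or
equidistribution of polynomial roots to composite moduli at resolution `(log)^{-1-ε}` (Hooley 1964; DFI 1995,
Tóth 2000 for quadratics; PNT in progressions via reciprocity for linear members); true for `k = 0` and `f = X`. -/
theorem stub_sawtoothMoment :
    ∀ (k : ℕ) (f : Fin k → Polynomial ℤ), Literature.NumberTheory.Sieve.IsBatemanHornSystem f →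
    let W : ℝ → ℕ → ℝ := fun σ n =>
      ∑ d ∈ (Fintype.piFinset (fun i => (((f i).eval (n : ℤ)).toNat).divisors)).filter
          (fun d => Finset.univ.lcm d < n),
        (∏ i, ((ArithmeticFunction.moebius (d i) : ℝ) * Real.log (d i))) *
          (((Finset.univ.lcm d : ℕ) : ℝ) ^ (-σ) *
            ((((n - 1) / Finset.univ.lcm d : ℕ) : ℝ) ^ (-σ) -
              ((((n - 1) / Finset.univ.lcm d : ℕ) : ℝ) + 1) ^ (-σ)) *
            (1 / 2 - ((n : ℝ) - ((Finset.univ.lcm d : ℕ) : ℝ) * (((n - 1) / Finset.univ.lcm d : ℕ) : ℝ)) /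
              ((Finset.univ.lcm d : ℕ) : ℝ)));
    (∀ σ : ℝ, 1 < σ → Summable (W σ)) ∧
      Filter.Tendsto (fun σ : ℝ => (σ - 1) * ∑' n : ℕ, W σ n) (nhdsWithin 1 (Set.Ioi 1)) (nhds 0) := by
  sorry

/-- stub (THE SIGN INPUT = the sibling crux `LambertRoots.MuRootWeyl`, stmt-Parity-16279, BY NAME — staffed
once, on route LambertRoots; size XL, open in degree ≥ 3): log-power Möbius cancellation
`|Σ_{lcm d ≤ D} ∏ᵢ μ(dᵢ) log dᵢ · S_f(j; d)| ≤ C·D/(log D)^A` in the joint-root Weyl sums for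
`0 < |j| ≤ (log D)^B`, every Bateman–Horn system, all `A, B > 0`. -/
theorem stub_muRootWeyl : Summit.Parity.BatemanHorn.Theses.LambertRoots.MuRootWeyl := by
  sorry

/-- stub (CONTINUOUS-KERNEL TRANSFER — theorem-grade, size L): `MuRootWeyl` implies that the continuous
piece `G(σ,n) = R(σ,n) - W(σ,n)` (the route's `δ_σ` minus the sawtooth term, same tuples and weights) is summable
for `σ > 1` with `(σ-1)·Σ_n G(σ,n) → 0` (in fact `Σ_n G = O(1)`).  Proof plan: per class the blocks sum to
`L^{-σ} G_σ(α)`, `G_σ = Φ_σ - (1/2 - ·)` continuous periodic, mean zero, `Ĝ_σ(h) = O(h^{-2})` uniformly in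
`σ ∈ (1,2]`; expand in the absolutely convergent Fourier series, Abel-sum `lcm^{-σ}` against the MuRootWeyl
bound with `A > 1`, `B > 2k` (frequencies `|h| ≤ (log D)^B`) and the trivial bound `≪ D (log D)^{2k-1}` below
`D = exp(|h|^{1/B})`; the finitely many `n` with some `fᵢ(n) ≤ 0` cost `O(1)`.  Mathlib: `AddCircle` Fourier
series (`fourierCoeff`, `hasSum_fourier_series_of_summable`), `Summable.tsum_add`, Abel/partial summation. -/
theorem stub_smoothKernel :
    Summit.Parity.BatemanHorn.Theses.LambertRoots.MuRootWeyl →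
    ∀ (k : ℕ) (f : Fin k → Polynomial ℤ), Literature.NumberTheory.Sieve.IsBatemanHornSystem f →
    let G : ℝ → ℕ → ℝ := fun σ n =>
      ∑ d ∈ (Fintype.piFinset (fun i => (((f i).eval (n : ℤ)).toNat).divisors)).filter
          (fun d => Finset.univ.lcm d < n),
        (∏ i, ((ArithmeticFunction.moebius (d i) : ℝ) * Real.log (d i))) *
          (((n : ℝ) ^ (-σ) -
              ((((Finset.univ.lcm d : ℕ) : ℝ) * ((((n - 1) / Finset.univ.lcm d : ℕ) : ℝ) + 1)) ^ (1 - σ) -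
                  (((Finset.univ.lcm d : ℕ) : ℝ) * (((n - 1) / Finset.univ.lcm d : ℕ) : ℝ)) ^ (1 - σ)) /
                ((1 - σ) * ((Finset.univ.lcm d : ℕ) : ℝ))) -
            ((Finset.univ.lcm d : ℕ) : ℝ) ^ (-σ) *
              ((((n - 1) / Finset.univ.lcm d : ℕ) : ℝ) ^ (-σ) -
                ((((n - 1) / Finset.univ.lcm d : ℕ) : ℝ) + 1) ^ (-σ)) *
              (1 / 2 - ((n : ℝ) - ((Finset.univ.lcm d : ℕ) : ℝ) * (((n - 1) / Finset.univ.lcm d : ℕ) : ℝ)) /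
                ((Finset.univ.lcm d : ℕ) : ℝ)));
    (∀ σ : ℝ, 1 < σ → Summable (G σ)) ∧
      Filter.Tendsto (fun σ : ℝ => (σ - 1) * ∑' n : ℕ, G σ n) (nhdsWithin 1 (Set.Ioi 1)) (nhds 0) := by
  sorry

/-! ### Glue (all proved): the kernel cut is an identity -/

/-- The weight `∏ᵢ μ(dᵢ) log dᵢ` of a divisor tuple. -/
noncomputable def weight {k : ℕ} (d : Fin k → ℕ) : ℝ :=
  ∏ i, ((ArithmeticFunction.moebius (d i) : ℝ) * Real.log (d i))

/-- The divisor tuples of the crux at `n`: `dᵢ ∣ fᵢ(n)` (as `toNat` divisors) with `lcm d < n`. -/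
noncomputable def tuples {k : ℕ} (f : Fin k → Polynomial ℤ) (n : ℕ) : Finset (Fin k → ℕ) :=
  (Fintype.piFinset (fun i => (((f i).eval (n : ℤ)).toNat).divisors)).filter (fun d => Finset.univ.lcm d < n)

/-- The route's Hurwitz difference `δ_σ(n,d) = n^{-σ} - ((a+L)^{1-σ} - a^{1-σ})/((1-σ)L)`, `a = L⌊(n-1)/L⌋`
(verbatim the bracket of `HurwitzTauber.RootHurwitzLaw`). -/
noncomputable def deltaTerm {k : ℕ} (d : Fin k → ℕ) (σ : ℝ) (n : ℕ) : ℝ :=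
  (n : ℝ) ^ (-σ) -
    ((((Finset.univ.lcm d : ℕ) : ℝ) * ((((n - 1) / Finset.univ.lcm d : ℕ) : ℝ) + 1)) ^ (1 - σ) -
        (((Finset.univ.lcm d : ℕ) : ℝ) * (((n - 1) / Finset.univ.lcm d : ℕ) : ℝ)) ^ (1 - σ)) /
      ((1 - σ) * ((Finset.univ.lcm d : ℕ) : ℝ))

/-- The sawtooth term `L^{-σ} (m^{-σ} - (m+1)^{-σ}) (1/2 - (n - Lm)/L)`, `m = ⌊(n-1)/L⌋` (the bracket of
`stub_sawtoothMoment`). -/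
noncomputable def sawTerm {k : ℕ} (d : Fin k → ℕ) (σ : ℝ) (n : ℕ) : ℝ :=
  ((Finset.univ.lcm d : ℕ) : ℝ) ^ (-σ) *
    ((((n - 1) / Finset.univ.lcm d : ℕ) : ℝ) ^ (-σ) - ((((n - 1) / Finset.univ.lcm d : ℕ) : ℝ) + 1) ^ (-σ)) *
    (1 / 2 - ((n : ℝ) - ((Finset.univ.lcm d : ℕ) : ℝ) * (((n - 1) / Finset.univ.lcm d : ℕ) : ℝ)) /
      ((Finset.univ.lcm d : ℕ) : ℝ))

/-- The crux's remainder term `R(σ,n)` (verbatim the `let R` of `HurwitzTauber.RootHurwitzLaw`). -/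
noncomputable def remainder {k : ℕ} (f : Fin k → Polynomial ℤ) (σ : ℝ) (n : ℕ) : ℝ :=
  ∑ d ∈ tuples f n, weight d * deltaTerm d σ n

/-- The sawtooth piece `W(σ,n)` (the `let W` of `stub_sawtoothMoment`). -/
noncomputable def sawPart {k : ℕ} (f : Fin k → Polynomial ℤ) (σ : ℝ) (n : ℕ) : ℝ :=
  ∑ d ∈ tuples f n, weight d * sawTerm d σ n

/-- The continuous-kernel piece `G(σ,n)` (the `let G` of `stub_smoothKernel`). -/
noncomputable def smoothPart {k : ℕ} (f : Fin k → Polynomial ℤ) (σ : ℝ) (n : ℕ) : ℝ :=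
  ∑ d ∈ tuples f n, weight d * (deltaTerm d σ n - sawTerm d σ n)

/-- **The cut is an identity**: `R(σ,n) = W(σ,n) + G(σ,n)` for every system, `σ` and `n`. [folklore] -/
theorem remainder_eq_saw_add_smooth {k : ℕ} (f : Fin k → Polynomial ℤ) (σ : ℝ) (n : ℕ) :
    remainder f σ n = sawPart f σ n + smoothPart f σ n := by
  unfold remainder sawPart smoothPart
  rw [← Finset.sum_add_distrib]
  refine Finset.sum_congr rfl fun d _ => ?_
  ring

/-- **Limit glue** (elementary): if `T = S + M` termwise and both `S`, `M` are summable for `σ > 1` with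
`(σ-1)·Σ' → 0` as `σ → 1⁺`, then so is `T`. [folklore] -/
theorem law_of_parts {S M T : ℝ → ℕ → ℝ} (hT : ∀ σ n, T σ n = S σ n + M σ n)
    (hS : (∀ σ : ℝ, 1 < σ → Summable (S σ)) ∧
      Filter.Tendsto (fun σ : ℝ => (σ - 1) * ∑' n : ℕ, S σ n) (nhdsWithin 1 (Set.Ioi 1)) (nhds 0))
    (hM : (∀ σ : ℝ, 1 < σ → Summable (M σ)) ∧
      Filter.Tendsto (fun σ : ℝ => (σ - 1) * ∑' n : ℕ, M σ n) (nhdsWithin 1 (Set.Ioi 1)) (nhds 0)) :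
    (∀ σ : ℝ, 1 < σ → Summable (T σ)) ∧
      Filter.Tendsto (fun σ : ℝ => (σ - 1) * ∑' n : ℕ, T σ n) (nhdsWithin 1 (Set.Ioi 1)) (nhds 0) := by
  refine ⟨fun σ hσ => ((hS.1 σ hσ).add (hM.1 σ hσ)).congr fun n => (hT σ n).symm, ?_⟩
  have h := hS.2.add hM.2
  rw [add_zero] at h
  refine h.congr' ?_
  filter_upwards [self_mem_nhdsWithin] with σ hσ
  have hσ' : 1 < σ := hσ
  rw [← mul_add, ← (hS.1 σ hσ').tsum_add (hM.1 σ hσ')]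
  congr 1
  exact tsum_congr fun n => (hT σ n).symm

/-! ### Composition: the three stubs give the crux BY NAME -/

/-- ASSEMBLY IN HYPOTHESIS FORM (kernel-checked, sorry-free; an `example`, because the skeleton audit admits
only named obligations as hypotheses of a crux-concluding theorem):
`stub_sawtoothMoment-sig → stub_muRootWeyl-sig → stub_smoothKernel-sig → RootHurwitzLaw`. -/
example
    (hsaw : ∀ (k : ℕ) (f : Fin k → Polynomial ℤ), Literature.NumberTheory.Sieve.IsBatemanHornSystem f →
      let W : ℝ → ℕ → ℝ := fun σ n =>
        ∑ d ∈ (Fintype.piFinset (fun i => (((f i).eval (n : ℤ)).toNat).divisors)).filter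
            (fun d => Finset.univ.lcm d < n),
          (∏ i, ((ArithmeticFunction.moebius (d i) : ℝ) * Real.log (d i))) *
            (((Finset.univ.lcm d : ℕ) : ℝ) ^ (-σ) *
              ((((n - 1) / Finset.univ.lcm d : ℕ) : ℝ) ^ (-σ) -
                ((((n - 1) / Finset.univ.lcm d : ℕ) : ℝ) + 1) ^ (-σ)) *
              (1 / 2 - ((n : ℝ) - ((Finset.univ.lcm d : ℕ) : ℝ) * (((n - 1) / Finset.univ.lcm d : ℕ) : ℝ)) /
                ((Finset.univ.lcm d : ℕ) : ℝ)));
      (∀ σ : ℝ, 1 < σ → Summable (W σ)) ∧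
        Filter.Tendsto (fun σ : ℝ => (σ - 1) * ∑' n : ℕ, W σ n) (nhdsWithin 1 (Set.Ioi 1)) (nhds 0))
    (hmrw : Summit.Parity.BatemanHorn.Theses.LambertRoots.MuRootWeyl)
    (hsmooth : Summit.Parity.BatemanHorn.Theses.LambertRoots.MuRootWeyl →
      ∀ (k : ℕ) (f : Fin k → Polynomial ℤ), Literature.NumberTheory.Sieve.IsBatemanHornSystem f →
      let G : ℝ → ℕ → ℝ := fun σ n =>
        ∑ d ∈ (Fintype.piFinset (fun i => (((f i).eval (n : ℤ)).toNat).divisors)).filter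
            (fun d => Finset.univ.lcm d < n),
          (∏ i, ((ArithmeticFunction.moebius (d i) : ℝ) * Real.log (d i))) *
            (((n : ℝ) ^ (-σ) -
                ((((Finset.univ.lcm d : ℕ) : ℝ) * ((((n - 1) / Finset.univ.lcm d : ℕ) : ℝ) + 1)) ^ (1 - σ) -
                    (((Finset.univ.lcm d : ℕ) : ℝ) * (((n - 1) / Finset.univ.lcm d : ℕ) : ℝ)) ^ (1 - σ)) /
                  ((1 - σ) * ((Finset.univ.lcm d : ℕ) : ℝ))) -
              ((Finset.univ.lcm d : ℕ) : ℝ) ^ (-σ) *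
                ((((n - 1) / Finset.univ.lcm d : ℕ) : ℝ) ^ (-σ) -
                  ((((n - 1) / Finset.univ.lcm d : ℕ) : ℝ) + 1) ^ (-σ)) *
                (1 / 2 - ((n : ℝ) - ((Finset.univ.lcm d : ℕ) : ℝ) * (((n - 1) / Finset.univ.lcm d : ℕ) : ℝ)) /
                  ((Finset.univ.lcm d : ℕ) : ℝ)));
      (∀ σ : ℝ, 1 < σ → Summable (G σ)) ∧
        Filter.Tendsto (fun σ : ℝ => (σ - 1) * ∑' n : ℕ, G σ n) (nhdsWithin 1 (Set.Ioi 1)) (nhds 0)) :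
    Summit.Parity.BatemanHorn.Theses.HurwitzTauber.RootHurwitzLaw := by
  intro k f hf R
  have hR : R = remainder f := rfl
  clear_value R
  subst hR
  have h1 : (∀ σ : ℝ, 1 < σ → Summable (sawPart f σ)) ∧
      Filter.Tendsto (fun σ : ℝ => (σ - 1) * ∑' n : ℕ, sawPart f σ n) (nhdsWithin 1 (Set.Ioi 1)) (nhds 0) :=
    hsaw k f hf
  have h2 : (∀ σ : ℝ, 1 < σ → Summable (smoothPart f σ)) ∧
      Filter.Tendsto (fun σ : ℝ => (σ - 1) * ∑' n : ℕ, smoothPart f σ n)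
        (nhdsWithin 1 (Set.Ioi 1)) (nhds 0) :=
    hsmooth hmrw k f hf
  exact law_of_parts (remainder_eq_saw_add_smooth f) h1 h2

/-- THE SKELETON THEOREM: the crux `HurwitzTauber.RootHurwitzLaw`, concluded BY NAME from the three registered
stubs (no `sorry` here; `#print axioms` today = the stubs' `sorryAx` + propext / Classical.choice / Quot.sound). -/
theorem RootHurwitzLaw_of : Summit.Parity.BatemanHorn.Theses.HurwitzTauber.RootHurwitzLaw := by
  intro k f hf R
  have hR : R = remainder f := rfl
  clear_value R
  subst hR
  have h1 : (∀ σ : ℝ, 1 < σ → Summable (sawPart f σ)) ∧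
      Filter.Tendsto (fun σ : ℝ => (σ - 1) * ∑' n : ℕ, sawPart f σ n) (nhdsWithin 1 (Set.Ioi 1)) (nhds 0) :=
    stub_sawtoothMoment k f hf
  have h2 : (∀ σ : ℝ, 1 < σ → Summable (smoothPart f σ)) ∧
      Filter.Tendsto (fun σ : ℝ => (σ - 1) * ∑' n : ℕ, smoothPart f σ n)
        (nhdsWithin 1 (Set.Ioi 1)) (nhds 0) :=
    stub_smoothKernel stub_muRootWeyl k f hf
  exact law_of_parts (remainder_eq_saw_add_smooth f) h1 h2

/-! ### Exactness of the split modulo the sibling crux (sorry-free): the crux and the continuous-kernel law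
give back the sawtooth stub, so `RootHurwitzLaw ∧ (MuRootWeyl → G-law) ∧ MuRootWeyl ⟹ W-law` — nothing is lost. -/

/-- The crux together with the conclusion of `stub_smoothKernel` implies the statement of
`stub_sawtoothMoment` (`W = R - G` termwise). [folklore] -/
theorem saw_of_rootHurwitzLaw_of_smooth
    (hR : Summit.Parity.BatemanHorn.Theses.HurwitzTauber.RootHurwitzLaw)
    (hG : ∀ (k : ℕ) (f : Fin k → Polynomial ℤ), Literature.NumberTheory.Sieve.IsBatemanHornSystem f →
      (∀ σ : ℝ, 1 < σ → Summable (smoothPart f σ)) ∧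
        Filter.Tendsto (fun σ : ℝ => (σ - 1) * ∑' n : ℕ, smoothPart f σ n)
          (nhdsWithin 1 (Set.Ioi 1)) (nhds 0))
    {k : ℕ} (f : Fin k → Polynomial ℤ) (hf : Literature.NumberTheory.Sieve.IsBatemanHornSystem f) :
    (∀ σ : ℝ, 1 < σ → Summable (sawPart f σ)) ∧
      Filter.Tendsto (fun σ : ℝ => (σ - 1) * ∑' n : ℕ, sawPart f σ n) (nhdsWithin 1 (Set.Ioi 1)) (nhds 0) := by
  have h1 : (∀ σ : ℝ, 1 < σ → Summable (remainder f σ)) ∧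
      Filter.Tendsto (fun σ : ℝ => (σ - 1) * ∑' n : ℕ, remainder f σ n) (nhdsWithin 1 (Set.Ioi 1)) (nhds 0) :=
    hR k f hf
  have h2 := hG k f hf
  have hneg : (∀ σ : ℝ, 1 < σ → Summable (fun n => -smoothPart f σ n)) ∧
      Filter.Tendsto (fun σ : ℝ => (σ - 1) * ∑' n : ℕ, -smoothPart f σ n)
        (nhdsWithin 1 (Set.Ioi 1)) (nhds 0) := by
    refine ⟨fun σ hσ => (h2.1 σ hσ).neg, ?_⟩
    have h := h2.2.neg
    rw [neg_zero] at h
    refine h.congr' (Filter.Eventually.of_forall fun σ => ?_)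
    show -((σ - 1) * ∑' n : ℕ, smoothPart f σ n) = (σ - 1) * ∑' n : ℕ, -smoothPart f σ n
    rw [tsum_neg, mul_neg]
  exact law_of_parts (S := remainder f) (M := fun σ n => -smoothPart f σ n)
    (fun σ n => by rw [remainder_eq_saw_add_smooth]; ring) h1 hneg

end Summit.Parity.BatemanHorn.Cruxes.RootHurwitzLaw.Birth
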